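import Mathlib
import HarnessLib
import Literature.Analysis.FluidPDE.ClassicalSolution
import Literature.Analysis.FluidPDE.ClassicalSolutionRegion
import Literature.Analysis.FluidPDE.SelfSimilar
import Literature.Analysis.FluidPDE.HyperbolicDSSOrbit
import Literature.Analysis.FluidPDE.PineauVicolOneSlice
import Summits.NavierStokesRegularity.NavierStokesRegularity.Theorems.QuarterLogPincerFlatWindowDefs
import Summits.NavierStokesRegularity.NavierStokesRegularity.Theorems.QuarterLogPincerTypeIQuantSubcubicExpFlatWindowSliceDictionary
import Summits.NavierStokesRegularity.NavierStokesRegularity.Theorems.QuarterLogPincerTypeIQuantSubcubicExpFlatWindowAnnulusPressure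
import Summits.NavierStokesRegularity.NavierStokesRegularity.Theorems.QuarterLogPincerTypeIQuantSubcubicExpFlatWindowExplicitWindow
import Summits.NavierStokesRegularity.NavierStokesRegularity.Theorems.QuarterLogPincerAnalyticWindowDefs
import Summits.NavierStokesRegularity.NavierStokesRegularity.Theorems.QuarterLogPincerTypeIQuantSubcubicExpAnalyticWindowGevreyFlatness

/-!
# LINE `analytic_window` of crux `TypeIQuantSubcubicExp` (stmt-NavierStokesRegularity-24077) — THE RUNG:
  the ∀-conditional analytic near-one DSS-exclusion window `analyticWindow_rung` (sorry-free) and its comparison lemma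

Author of every statement and proof below: **ns-idea-7 g6** (line `analytic_window`, tree copy v4 sha12 `2d3691688f08`;
critics idea-crit-7 g3 BACKSTOP 15:07:08Z + idea-crit-4 g5 PASS 15:22:20Z). Texts VERBATIM (same namespace
`…Cruxes.TypeIQuantSubcubicExp.AnalyticWindow`, same names), only re-homed into an importable module — crux workfiles
under `Cruxes/…/Lines/` are not importable from `Theorems/`. Landed by ns-tc-p1 g5 (LEAD lineage of 24077) on
DIRECTOR-NS #244 (b), `--supports stmt-NavierStokesRegularity-24077 --as helper`.

* `window_comparison` — at the acceleration constant `B_G = 2C₁/θ²` certified by the same Gevrey data, the log-window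
  `θ/(4 log(9C₁/(θδ₀)))` dominates the tree-shaped linear window `δ₀/(2B_G)` whenever `9C₁/(θδ₀) ≥ 32` (against the
  tree's OPTIMAL `B` the comparison is undecided — no constant is pinned in tree or print; idea-crit-4 P1/P3);
* `regularApex_of_flatOnBall` — flatness on the inspected ball `‖y‖ ≤ 2e^{s₀/2}` only ⇒ regular apex (Thm 1.9 at the
  slice `t̄ = −e^{−s₀}/4`, tree dictionary `SliceDictionary`);
* `window_arith`, `flatOnBall_of_window` (S1 `gevreyFlatness_holds` + the window arithmetic ⇒ `δ₀`-flat lines);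
* `removingDss_analyticWindow_of` and **`analyticWindow_rung`**: for ALL admissible data (`OneSliceThresholdAt C₀ δ₀ Cp s₀`,
  `AnnulusPressure C₀ Cp`, `ProfileGevreyBound C₀ (2e^{s₀/2}) C₁ θ`, ranges) every `λ`-DSS classical ancient solution of
  the class `HasTypeIDecay C₀` with `1 < λ ≤ exp(θ/(4 log(9C₁/(θδ₀))))` vanishes — window LOGARITHMIC in the one-slice
  threshold `δ₀` at fixed Gevrey data (tree rung `FlatWindow.removingDss_explicitWindow`, p633176: `exp(δ₀/(2B))`, linear).
  Uses the LANDED flat_window obligations `stub_sliceDictionary` (p629490) and `eq_zero_of_dss_of_bounded_apex` (p633176).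

NOT landed here (they depend on the line's only `sorry`, S2a `stub_slabJets`): `profileGevreyBoundMild_exists`,
`profileGevreyBound_exists`, `analyticWindow_rung_exists`, `analyticWindow_rung_ranges` (the last is, AS TYPED, implied by
p633176 by arithmetic — idea-crit-7 g3 / ns-afl-r1 `Negative/AnalyticWindowRungTyped.lean`).

HONEST FRAMING: a RUNG line on the DSS wall, NEAR-ONE LANE ONLY (barrier `NearOneDssTypeIExclusion`, one-slice
conjunct); it does NOT conclude the crux `TypeIQuantSubcubicExp` (24077), does not narrow S3 `stub_thinCascadeLiouville`
of `Lines/thin_cascade.lean`, and proves no summit statement; NS regularity is OPEN. The line's only `sorry`, S2a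
`stub_slabJets` (class-uniform analyticity jets), is NOT in this file and is keyed to no prover.
-/

noncomputable section

-- the summit-side namespace repeats a component by design (D-0017)
set_option linter.dupNamespace false

namespace Summit.NavierStokesRegularity.NavierStokesRegularity.Cruxes.TypeIQuantSubcubicExp.AnalyticWindow

open MeasureTheory Set Function Filter Topology Metric
open scoped Nat
open Literature.Analysis Literature.Analysis.FluidPDE Literature.Analysis.Calculus
open Summit.NavierStokesRegularity.NavierStokesRegularity.Cruxes.TypeIQuantSubcubicExp.FlatWindow

/-! ### The comparison lemma (verbatim from `Lines/analytic_window.lean` v4) -/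

/-- **P3, the provable half of the instrument row.** At the acceleration constant certified by the SAME
Gevrey data, `B_G = 2C₁/θ²` (`accel_of_gevrey`), the analytic log-window dominates the tree-shaped linear
window: `δ₀/(2B_G) ≤ θ/(4 log(9C₁/(θδ₀)))` as soon as `9C₁/(θδ₀) ≥ 32` — in particular whenever
`δ₀ ≤ 9/32`, since `C₁/θ ≥ 1`.  (Against the tree's OPTIMAL `B` the comparison `θB ≥ 2δ₀ log(9C₁/(θδ₀))`
is undecided: no constant is pinned in tree or print.) -/
theorem window_comparison {δ₀ θ C₁ : ℝ} (hδ₀ : 0 < δ₀) (hθ : 0 < θ) (hC₁ : 1 ≤ C₁)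
    (hz : 32 ≤ 9 * C₁ / (θ * δ₀)) :
    δ₀ / (2 * (2 * C₁ / θ ^ 2)) ≤ θ / (4 * Real.log (9 * C₁ / (θ * δ₀))) := by
  set z : ℝ := 9 * C₁ / (θ * δ₀) with hzdef
  have hz0 : 0 < z := by positivity
  have hC0 : 0 < C₁ := by linarith
  -- `log z ≤ z/9` for `z ≥ 32`
  have hlog2 : Real.log 2 < 0.6931471808 := Real.log_two_lt_d9
  have hlog32 : Real.log 32 = 5 * Real.log 2 := by
    rw [show (32 : ℝ) = 2 ^ 5 by norm_num, Real.log_pow]; norm_num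
  have hL : Real.log z ≤ z / 9 := by
    have h1 : Real.log z = Real.log 32 + Real.log (z / 32) := by
      rw [← Real.log_mul (by norm_num) (by positivity)]; congr 1; field_simp
    have h2 : Real.log (z / 32) ≤ z / 32 - 1 := Real.log_le_sub_one_of_pos (by positivity)
    rw [h1, hlog32]; nlinarith
  have hLpos : 0 < Real.log z := Real.log_pos (by linarith)
  -- algebra: `δ₀θ²/(4C₁) ≤ θ/(4 log z)` iff `δ₀ θ log z ≤ C₁`, and `δ₀ θ (z/9) = C₁`
  have hkey : δ₀ * θ * Real.log z ≤ C₁ := by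
    have : δ₀ * θ * (z / 9) = C₁ := by rw [hzdef]; field_simp
    nlinarith [mul_pos hδ₀ hθ]
  have hr : θ * (2 * (2 * C₁ / θ ^ 2)) = 4 * C₁ / θ := by field_simp; ring
  rw [div_le_div_iff₀ (by positivity) (by positivity), hr, le_div_iff₀ hθ]
  nlinarith [hkey]

/-! ### Proved: the compositions (verbatim) -/

/-- **Regular apex from flatness ON THE INSPECTED BALL ONLY.** If the profile lines with labels
`‖y‖ ≤ 2e^{s₀/2}` are `δ₀`-flat at all times, the apex is regular: the slice `t̄ = −e^{−s₀}/4` of Thm 1.9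
inspects exactly the labels `y = x/√(−t̄) = 2e^{s₀/2}x`, `‖x‖ < 1`. -/
theorem regularApex_of_flatOnBall (hdict : SliceDictionary) {C₀ δ₀ Cp s₀ : ℝ}
    (hT : OneSliceThresholdAt C₀ δ₀ Cp s₀) (hs₀ : 1 ≤ s₀)
    {u : ℝ → EuclideanSpace ℝ (Fin 3) → EuclideanSpace ℝ (Fin 3)} {p p' : ℝ → EuclideanSpace ℝ (Fin 3) → ℝ}
    (hsol : IsClassicalNSSolutionOn (Iio 0) 1 0 u p) (hdec : HasTypeIDecay C₀ u)
    (hreg : IsClassicalNSSolutionOnRegion pvRegion 1 0 u p')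
    (hpb : ∀ t ∈ Ico (-1 : ℝ) 0, ∀ x : EuclideanSpace ℝ (Fin 3), 1 / 2 < ‖x‖ → ‖x‖ < 3 / 4 → |p' t x| ≤ Cp)
    (hflat : ∀ (s : ℝ) (y : EuclideanSpace ℝ (Fin 3)), ‖y‖ ≤ 2 * Real.exp (s₀ / 2) →
      ‖deriv (profileLine u y) s‖ ≤ δ₀) :
    ∃ r : ℝ, 0 < r ∧ ∃ M : ℝ, ∀ t : ℝ, -r ^ 2 < t → t < 0 →
      ∀ x ∈ ball (0 : EuclideanSpace ℝ (Fin 3)) r, ‖u t x‖ ≤ M := by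
  have henv : ∀ t ∈ Ico (-1 : ℝ) 0, ∀ x ∈ ball (0 : EuclideanSpace ℝ (Fin 3)) 1,
      ‖u t x‖ ≤ C₀ / (Real.sqrt (-t) + ‖x‖) := by
    intro t ht x _
    rw [add_comm]
    exact hdec t ht.2 x
  -- the slice `t̄ = −e^{−s₀}/4`
  set tbar : ℝ := -Real.exp (-s₀) / 4 with htbar
  have hpos : 0 < Real.exp (-s₀) := Real.exp_pos _
  have h1 : -Real.exp (-s₀) < tbar := by rw [htbar]; linarith
  have h2 : tbar < 0 := by rw [htbar]; linarith
  have h3 : -1 < tbar := by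
    have : Real.exp (-s₀) ≤ 1 := by rw [Real.exp_le_one_iff]; linarith
    linarith
  -- `√(−t̄) = e^{−s₀/2}/2`, so `1/√(−t̄) = 2 e^{s₀/2}`
  have hsq : Real.sqrt (-tbar) = Real.exp (-s₀ / 2) / 2 := by
    have hnn : 0 ≤ Real.exp (-s₀ / 2) / 2 := by positivity
    have : -tbar = (Real.exp (-s₀ / 2) / 2) ^ 2 := by
      rw [htbar, div_pow, ← Real.exp_nat_mul]
      ring_nf
    rw [this, Real.sqrt_sq hnn]
  have hinv : (Real.sqrt (-tbar))⁻¹ = 2 * Real.exp (s₀ / 2) := by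
    have hmul : Real.exp (-s₀ / 2) * Real.exp (s₀ / 2) = 1 := by
      rw [← Real.exp_add]
      have : -s₀ / 2 + s₀ / 2 = 0 := by ring
      rw [this, Real.exp_zero]
    rw [hsq, inv_div, div_eq_iff (Real.exp_pos _).ne']
    linear_combination (-2) * hmul
  refine hT u p' hreg henv hpb tbar h1 h2 fun x hx => ?_
  rw [hdict u p hsol tbar h3 h2 x hx]
  apply hflat
  rw [norm_smul, hinv, Real.norm_eq_abs, abs_of_pos (by positivity)]
  have hx1 : ‖x‖ < 1 := by simpa using hx
  have h2e : 0 < 2 * Real.exp (s₀ / 2) := by positivity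
  nlinarith [norm_nonneg x]

/-- **The window arithmetic.** With `C₁ ≥ 1`, `θ, δ₀ ∈ (0,1]` and `0 < S ≤ θ/(2 log(9C₁/(θδ₀)))`:
`S ≤ θ` and `9C₁θ⁻¹e^{−θ/(2S)} ≤ δ₀`. -/
theorem window_arith {C₁ θ δ₀ S : ℝ} (hC₁ : 1 ≤ C₁) (hθ : 0 < θ) (hθ1 : θ ≤ 1) (hδ₀ : 0 < δ₀)
    (hδ₁ : δ₀ ≤ 1) (hS : 0 < S) (hwin : S ≤ θ / (2 * Real.log (9 * C₁ / (θ * δ₀)))) :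
    S ≤ θ ∧ 9 * C₁ / θ * Real.exp (-(θ / (2 * S))) ≤ δ₀ := by
  have hC₁pos : 0 < C₁ := by linarith
  have hθ0 : θ ≠ 0 := hθ.ne'
  have hC0 : C₁ ≠ 0 := hC₁pos.ne'
  have hθδ : 0 < θ * δ₀ := mul_pos hθ hδ₀
  have hθδ1 : θ * δ₀ ≤ 1 := by
    calc θ * δ₀ ≤ 1 * 1 := mul_le_mul hθ1 hδ₁ hδ₀.le zero_le_one
      _ = 1 := by ring
  have hQpos : 0 < 9 * C₁ / (θ * δ₀) := by positivity
  have hQ9 : 9 ≤ 9 * C₁ / (θ * δ₀) := by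
    rw [le_div_iff₀ hθδ]
    have := mul_le_mul_of_nonneg_left (hθδ1.trans hC₁) (by norm_num : (0 : ℝ) ≤ 9)
    linarith
  have hL1 : 1 ≤ Real.log (9 * C₁ / (θ * δ₀)) := by
    have he : Real.exp 1 ≤ 9 * C₁ / (θ * δ₀) := by
      have h9 : Real.exp 1 ≤ 9 := by
        have := Real.exp_one_lt_d9
        linarith
      exact h9.trans hQ9
    have := Real.log_le_log (Real.exp_pos 1) he
    rwa [Real.log_exp] at this
  have hEL : Real.exp (-Real.log (9 * C₁ / (θ * δ₀))) = θ * δ₀ / (9 * C₁) := by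
    rw [Real.exp_neg, Real.exp_log hQpos, inv_div]
  generalize Real.log (9 * C₁ / (θ * δ₀)) = L at hwin hL1 hEL
  have hLpos : 0 < L := by linarith
  constructor
  · have : θ / (2 * L) ≤ θ := by
      rw [div_le_iff₀ (by positivity)]
      nlinarith
    exact hwin.trans this
  · have h1 : L ≤ θ / (2 * S) := by
      rw [le_div_iff₀ (by positivity)]
      have h := mul_le_mul_of_nonneg_left hwin (by positivity : (0 : ℝ) ≤ 2 * L)
      have h' : 2 * L * (θ / (2 * L)) = θ := by field_simp
      calc L * (2 * S) = 2 * L * S := by ring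
        _ ≤ 2 * L * (θ / (2 * L)) := h
        _ = θ := h'
    have h2 : Real.exp (-(θ / (2 * S))) ≤ θ * δ₀ / (9 * C₁) := by
      rw [← hEL]
      exact Real.exp_le_exp.mpr (by linarith)
    calc 9 * C₁ / θ * Real.exp (-(θ / (2 * S))) ≤ 9 * C₁ / θ * (θ * δ₀ / (9 * C₁)) :=
          mul_le_mul_of_nonneg_left h2 (by positivity)
      _ = δ₀ := by field_simp

set_option maxHeartbeats 400000 in
/-- **Flatness on the inspected ball inside the analytic window.** If the profile lines on `‖y‖ ≤ R` are
Gevrey-1 (`C₁ ≥ 1`, `0 < θ ≤ 1`), `0 < δ₀ ≤ 1`, and the period `S = 2 log λ` satisfies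
`S ≤ θ/(2 log(9C₁/(θδ₀)))`, then every such line of a `λ`-DSS solution is `δ₀`-flat. -/
theorem flatOnBall_of_window {C₀ R C₁ θ δ₀ c : ℝ} (hG : ProfileGevreyBound C₀ R C₁ θ)
    (hC₁ : 1 ≤ C₁) (hθ : 0 < θ) (hθ1 : θ ≤ 1) (hδ₀ : 0 < δ₀) (hδ₁ : δ₀ ≤ 1) (hc : 1 < c)
    (hwin : 2 * Real.log c ≤ θ / (2 * Real.log (9 * C₁ / (θ * δ₀))))
    {u : ℝ → EuclideanSpace ℝ (Fin 3) → EuclideanSpace ℝ (Fin 3)} {p : ℝ → EuclideanSpace ℝ (Fin 3) → ℝ}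
    (hsol : IsClassicalNSSolutionOn (Iio 0) 1 0 u p) (hdss : IsDiscretelySelfSimilar c u)
    (hdec : HasTypeIDecay C₀ u) :
    ∀ (s : ℝ) (y : EuclideanSpace ℝ (Fin 3)), ‖y‖ ≤ R → ‖deriv (profileLine u y) s‖ ≤ δ₀ := by
  intro s y hy
  have hc0 : 0 < c := lt_trans zero_lt_one hc
  have hS : 0 < 2 * Real.log c := by have := Real.log_pos hc; linarith
  obtain ⟨hSθ, hδ⟩ := window_arith hC₁ hθ hθ1 hδ₀ hδ₁ hS hwin
  -- periodicity and the Gevrey bound of the line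
  obtain ⟨hCk, hgev⟩ := hG u p hsol hdec y hy
  have hper : Function.Periodic (profileLine u y) (2 * Real.log c) := by
    intro σ
    have := hdss.periodic_lerayOrbit hc0 σ
    simpa [profileLine] using congrFun this y
  exact (gevreyFlatness_holds hS hSθ hper hCk hgev s).trans hδ

/-- **The analytic window theorem from the obligations.** One-slice threshold `δ₀ ≤ 1` at slice parameter
`s₀`, annulus pressure, dictionary, and Gevrey-1 profile lines on the inspected ball `‖y‖ ≤ 2e^{s₀/2}` give:
every `λ`-DSS envelope-class (`C₀`) classical ancient solution with `2 log λ ≤ θ/(2 log(9C₁/(θδ₀)))` is zero. -/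
theorem removingDss_analyticWindow_of (hdict : SliceDictionary) {C₀ δ₀ Cp s₀ C₁ θ : ℝ}
    (hT : OneSliceThresholdAt C₀ δ₀ Cp s₀) (hs₀ : 1 ≤ s₀) (hδ₀ : 0 < δ₀) (hδ₁ : δ₀ ≤ 1)
    (hP : AnnulusPressure C₀ Cp) (hG : ProfileGevreyBound C₀ (2 * Real.exp (s₀ / 2)) C₁ θ)
    (hC₁ : 1 ≤ C₁) (hθ : 0 < θ) (hθ1 : θ ≤ 1) :
    ∀ c : ℝ, 1 < c → 2 * Real.log c ≤ θ / (2 * Real.log (9 * C₁ / (θ * δ₀))) →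
      ∀ (u : ℝ → EuclideanSpace ℝ (Fin 3) → EuclideanSpace ℝ (Fin 3)) (p : ℝ → EuclideanSpace ℝ (Fin 3) → ℝ),
        IsClassicalNSSolutionOn (Iio 0) 1 0 u p → IsDiscretelySelfSimilar c u → HasTypeIDecay C₀ u →
        ∀ t < 0, ∀ x, u t x = 0 := by
  intro c hc hwin u p hsol hdss hdec
  obtain ⟨p', hreg, hpb⟩ := hP u p hsol hdec
  have hflat := flatOnBall_of_window hG hC₁ hθ hθ1 hδ₀ hδ₁ hc hwin hsol hdss hdec
  obtain ⟨r, hr, M, hM⟩ := regularApex_of_flatOnBall hdict hT hs₀ hsol hdec hreg hpb hflat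
  exact eq_zero_of_dss_of_bounded_apex hc hdss hr hM

/-- **RUNG of the line (v3, critic P1): the displayed ANALYTIC window, for ALL admissible data.**  For every
envelope constant `C₀`, every one-slice threshold datum `(δ₀, Cp, s₀)` (Pineau–Vicol Thm 1.9: `OneSliceThresholdAt`,
annulus pressure `AnnulusPressure`), and every Gevrey-1 datum `(C₁, θ)` of the profile lines on the inspected ball
`‖y‖ ≤ 2e^{s₀/2}` (`ProfileGevreyBound`), every `λ`-DSS classical ancient solution of the class `HasTypeIDecay C₀` with

  `1 < λ ≤ exp( θ / (4 log(9 C₁/(θ δ₀))) )`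

vanishes identically.  SORRY-FREE (it uses S1 `gevreyFlatness_holds`, the tree dictionary `stub_sliceDictionary`
p629490 and the tree apex/Liouville steps; it does NOT use S2 — S2 `stub_profileGevreyBoundMild` is what makes the
Gevrey hypothesis dischargeable for every `C₀, R`, see `analyticWindow_rung_exists`).  The window is LOGARITHMIC in
`δ₀` at fixed Gevrey data, versus the tree's `exp(δ₀/(2B))` (`removingDss_explicitWindow`, p633176), linear at
fixed `B`; `window_comparison` is the provable half of that comparison.  This does NOT conclude the crux
`TypeIQuantSubcubicExp` (24077), narrows no open stub of `thin_cascade` (S3 = every `λ > 1`), and proves no summit. -/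
theorem analyticWindow_rung {C₀ δ₀ Cp s₀ C₁ θ : ℝ}
    (hT : OneSliceThresholdAt C₀ δ₀ Cp s₀) (hs₀ : 1 ≤ s₀) (hδ₀ : 0 < δ₀) (hδ₁ : δ₀ ≤ 1)
    (hP : AnnulusPressure C₀ Cp) (hG : ProfileGevreyBound C₀ (2 * Real.exp (s₀ / 2)) C₁ θ)
    (hC₁ : 1 ≤ C₁) (hθ : 0 < θ) (hθ1 : θ ≤ 1) :
    ∀ c : ℝ, 1 < c → c ≤ Real.exp (θ / (4 * Real.log (9 * C₁ / (θ * δ₀)))) →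
      ∀ (u : ℝ → EuclideanSpace ℝ (Fin 3) → EuclideanSpace ℝ (Fin 3)) (p : ℝ → EuclideanSpace ℝ (Fin 3) → ℝ),
        IsClassicalNSSolutionOn (Iio 0) 1 0 u p → IsDiscretelySelfSimilar c u → HasTypeIDecay C₀ u →
        ∀ t < 0, ∀ x, u t x = 0 := by
  intro c hc hcc u p hsol hdss hdec
  have hLpos : 0 < Real.log (9 * C₁ / (θ * δ₀)) := by
    apply Real.log_pos
    rw [lt_div_iff₀ (mul_pos hθ hδ₀)]
    have : θ * δ₀ ≤ 1 := by nlinarith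
    nlinarith
  have hwin : 2 * Real.log c ≤ θ / (2 * Real.log (9 * C₁ / (θ * δ₀))) := by
    have h := Real.log_le_log (lt_trans zero_lt_one hc) hcc
    rw [Real.log_exp] at h
    have h4 : θ / (4 * Real.log (9 * C₁ / (θ * δ₀))) * 2 = θ / (2 * Real.log (9 * C₁ / (θ * δ₀))) := by
      field_simp
      ring
    linarith [h4]
  exact removingDss_analyticWindow_of stub_sliceDictionary hT hs₀ hδ₀ hδ₁ hP hG hC₁ hθ hθ1 c hc hwin u p
    hsol hdss hdec

end Summit.NavierStokesRegularity.NavierStokesRegularity.Cruxes.TypeIQuantSubcubicExp.AnalyticWindow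

end
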